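import Summits.Schanuel.Schanuel.Theorems.RootDecomp1KGapCell09

/-!
# RootDecomp1KGapCell — lens 1, generation 42 «GAP CELL / INTERLACED SPECIALISATION» (lane K-R26 (α-loc)): the walls (1, ℓ_b, ρ), (1, ℓ₂, ℓ₃, ρ) (mod hNW), their π-twins and the 31077 pair (ℓ_b, ρ) HYPOTHESIS-FREE for every ρ ∈ `FactorialGapLiouville` — located order data strictly below the log-log floor; member ρ_W — continuation (RootDecomp1KGapCell10): §10 `form_lower_bound_G4`, `not_hyperLinLiouville_zG4/zG4pi`, `finiteOrderLiouvilleSchanuel_at_zG4`, `item33364_at_zG4`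

(lens-1 g42 `GapCell.lean` EDITION 3 [HOME/decomp-schanuel-lens-1/g42/ sha256 6f7828b1…, 2470 l; VERDICT L2004, EDITIONS 2+3 L2018, ACK L2023]; port by census-1 gen 17 as
`RootDecomp1KGapCell01`–`10` — see the PORT NOTE of part 01; `--supports stmt-Schanuel-33364` (04: `stmt-Schanuel-31077`); rung 0.)
-/

open Summit.Schanuel.Schanuel.Theorems.RootDecomp1KHyper
open Summit.Schanuel.Schanuel.Theorems.RootDecomp1KHyper.HyperCell
open Summit.Schanuel.Schanuel.Theorems.RootDecomp1KRelLiouvilleCell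
open Summit.Schanuel.Schanuel.Theorems.RootDecomp1KLogLogCell
open Summit.Schanuel.Schanuel.Theorems.RootDecomp1KTwoBaseCell
open LiouvilleNumber
open scoped Nat

namespace Summit.Schanuel.Schanuel.Theorems.RootDecomp1KGapCell

variable {k n : ℕ}

section FourScales

/-- Upper bound for the tail in base `m ≥ 2`: `r_k ≤ 2·m^{-(k+1)!}` (tree twin: TwoBaseCell04 `remainder_le`). -/
private theorem remainder_le'' {m : ℝ} (hm : 2 ≤ m) (k : ℕ) : remainder m k ≤ 2 / m ^ (k + 1)! := by
  have m1 : (1 : ℝ) < m := by linarith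
  have h := remainder_lt' k m1
  have hhalf : (1 : ℝ) / m ≤ 1 / 2 := one_div_le_one_div_of_le two_pos hm
  have hpos : (0 : ℝ) < 1 - 1 / m := by linarith
  have hinv : (1 - 1 / m)⁻¹ ≤ 2 := by
    rw [inv_le_comm₀ hpos two_pos]
    linarith
  have hmk : (0 : ℝ) < 1 / m ^ (k + 1)! := by positivity
  calc remainder m k ≤ (1 - 1 / m)⁻¹ * (1 / m ^ (k + 1)!) := h.le
    _ ≤ 2 * (1 / m ^ (k + 1)!) := mul_le_mul_of_nonneg_right hinv hmk.le
    _ = 2 / m ^ (k + 1)! := by ring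

/-- Approximation of the four-term form by its truncation at cut `(K, M)` (`ℓ₂, ℓ₃` both cut at `K`). -/
private theorem formG4_approx (g : Fin 4 → ℤ) (K M : ℕ) :
    |((g 0 : ℝ) + g 1 * liouvilleNumber 2 + g 2 * liouvilleNumber 3 + g 3 * rhoW) -
      ((g 0 : ℝ) + g 1 * partialSum 2 K + g 2 * partialSum 3 K + g 3 * tW M)| ≤
      (|(g 1 : ℝ)| + |(g 2 : ℝ)|) * (2 / 2 ^ (K + 1)!) + |(g 3 : ℝ)| * (2 / (2 : ℝ) ^ cW (M + 1)) := by
  have h2 := partialSum_add_remainder (by norm_num : (1 : ℝ) < 2) K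
  have h3 := partialSum_add_remainder (by norm_num : (1 : ℝ) < 3) K
  have hW := rhoW_eq_tW_add M
  have r2le : remainder 2 K ≤ 2 / 2 ^ (K + 1)! := remainder_le'' (by norm_num) K
  have r3le : remainder 3 K ≤ 2 / 2 ^ (K + 1)! := by
    refine (remainder_le'' (by norm_num) K).trans ?_
    gcongr; norm_num
  have r2pos := remainder_pos (by norm_num : (1 : ℝ) < 2) K
  have r3pos := remainder_pos (by norm_num : (1 : ℝ) < 3) K
  have tle := tailW_le M
  have tpos := tailW_pos M
  have e : ((g 0 : ℝ) + g 1 * liouvilleNumber 2 + g 2 * liouvilleNumber 3 + g 3 * rhoW) -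
      ((g 0 : ℝ) + g 1 * partialSum 2 K + g 2 * partialSum 3 K + g 3 * tW M) =
      g 1 * remainder 2 K + g 2 * remainder 3 K + g 3 * ∑' j, aW (j + (M + 1)) := by
    rw [← h2, ← h3, hW]; ring
  rw [e]
  calc |(g 1 : ℝ) * remainder 2 K + g 2 * remainder 3 K + g 3 * ∑' j, aW (j + (M + 1))|
      ≤ |(g 1 : ℝ)| * remainder 2 K + |(g 2 : ℝ)| * remainder 3 K +
          |(g 3 : ℝ)| * ∑' j, aW (j + (M + 1)) := by
        refine (abs_add_le _ _).trans (add_le_add ((abs_add_le _ _).trans ?_) ?_)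
        · rw [abs_mul, abs_mul, abs_of_pos r2pos, abs_of_pos r3pos]
        · rw [abs_mul, abs_of_pos tpos]
    _ ≤ |(g 1 : ℝ)| * (2 / 2 ^ (K + 1)!) + |(g 2 : ℝ)| * (2 / 2 ^ (K + 1)!) +
          |(g 3 : ℝ)| * (2 / (2 : ℝ) ^ cW (M + 1)) := by gcongr
    _ = (|(g 1 : ℝ)| + |(g 2 : ℝ)|) * (2 / 2 ^ (K + 1)!) + |(g 3 : ℝ)| * (2 / (2 : ℝ) ^ cW (M + 1)) := by
        ring

/-- Scale lower bound at cut `(K, M)`: a NON-ZERO truncation is `≥ 1/(2^e · 3^{K!})` whenever `K! ≤ e` and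
`c_M ≤ e` (TWO radices: common denominator `2^e 3^{K!}`). -/
private theorem formG4_scale_lower (g : Fin 4 → ℤ) {K M e : ℕ} (hK : K ! ≤ e) (hM : cW M ≤ e)
    (hne : (g 0 : ℝ) + g 1 * partialSum 2 K + g 2 * partialSum 3 K + g 3 * tW M ≠ 0) :
    1 / ((2 : ℝ) ^ e * 3 ^ K !) ≤ |(g 0 : ℝ) + g 1 * partialSum 2 K + g 2 * partialSum 3 K + g 3 * tW M| := by
  have hp2 : partialSum 2 K = (psNumer 2 K : ℝ) / 2 ^ K ! := by
    have := partialSum_eq_psNumer_div (by norm_num : 0 < 2) K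
    push_cast at this
    exact this
  have hp3 : partialSum 3 K = (psNumer 3 K : ℝ) / 3 ^ K ! := by
    have := partialSum_eq_psNumer_div (by norm_num : 0 < 3) K
    push_cast at this
    exact this
  set I : ℤ := g 0 * 2 ^ e * 3 ^ K ! + g 1 * (psNumer 2 K) * 2 ^ (e - K !) * 3 ^ K ! +
    g 2 * (psNumer 3 K) * 2 ^ e + g 3 * (MW M) * 2 ^ (e - cW M) * 3 ^ K ! with hI
  have hΦ : (g 0 : ℝ) + g 1 * partialSum 2 K + g 2 * partialSum 3 K + g 3 * tW M =
      (I : ℝ) / (2 ^ e * 3 ^ K !) := by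
    rw [hp2, hp3, tW_eq, hI]
    push_cast
    rw [pow_sub₀ _ (two_ne_zero) hK, pow_sub₀ _ (two_ne_zero) hM]
    field_simp
  rw [hΦ] at hne ⊢
  have hI0 : I ≠ 0 := by
    intro h0; apply hne; rw [h0]; simp
  have hI1 : (1 : ℝ) ≤ |(I : ℝ)| := by exact_mod_cast Int.one_le_abs hI0
  rw [abs_div, abs_of_pos (by positivity : (0 : ℝ) < 2 ^ e * 3 ^ K !)]
  exact div_le_div_of_nonneg_right hI1 (by positivity)

/-- **Three interlaced cuts, two radices:** if the truncations at `(N, N)`, `(N+1, N)`, `(N+1, N+1)` all vanish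
and `|g₁| < 2^{(N+1)!}` then `g₁ = g₂ = g₃ = 0` (last difference `g₃ · 2^{−c_{N+1}}`; middle difference
`g₁ 2^{−(N+1)!} + g₂ 3^{−(N+1)!}`, then coprimality — the tree's two-scale step of TwoBaseCell07, adapted). -/
private theorem formG4_three_cut (g : Fin 4 → ℤ) (N : ℕ)
    (h1 : (g 0 : ℝ) + g 1 * partialSum 2 N + g 2 * partialSum 3 N + g 3 * tW N = 0)
    (h2 : (g 0 : ℝ) + g 1 * partialSum 2 (N + 1) + g 2 * partialSum 3 (N + 1) + g 3 * tW N = 0)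
    (h3 : (g 0 : ℝ) + g 1 * partialSum 2 (N + 1) + g 2 * partialSum 3 (N + 1) + g 3 * tW (N + 1) = 0)
    (hsmall : |g 1| < (2 : ℤ) ^ (N + 1)!) : g 1 = 0 ∧ g 2 = 0 ∧ g 3 = 0 := by
  have tS : tW (N + 1) = tW N + aW (N + 1) := by unfold tW; rw [Finset.sum_range_succ]
  rw [tS] at h3
  have d3 : (g 3 : ℝ) * aW (N + 1) = 0 := by linear_combination h3 - h2
  have hg3 : g 3 = 0 := by
    have h : (g 3 : ℝ) = 0 := (mul_eq_zero.mp d3).resolve_right (aW_pos _).ne'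
    exact_mod_cast h
  rw [partialSum_succ, partialSum_succ] at h2
  have hd : (g 1 : ℝ) / 2 ^ (N + 1)! + g 2 / 3 ^ (N + 1)! = 0 := by linear_combination h2 - h1
  have hz : (g 1 : ℝ) * 3 ^ (N + 1)! + g 2 * 2 ^ (N + 1)! = 0 := by
    have h2' : (2 : ℝ) ^ (N + 1)! ≠ 0 := by positivity
    have h3' : (3 : ℝ) ^ (N + 1)! ≠ 0 := by positivity
    field_simp at hd
    linear_combination hd
  have hzZ : g 1 * 3 ^ (N + 1)! + g 2 * 2 ^ (N + 1)! = (0 : ℤ) := by exact_mod_cast hz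
  have hdvd : (2 : ℤ) ^ (N + 1)! ∣ g 1 * 3 ^ (N + 1)! := ⟨-(g 2), by linear_combination hzZ⟩
  have hcop : IsCoprime ((2 : ℤ) ^ (N + 1)!) ((3 : ℤ) ^ (N + 1)!) :=
    (show IsCoprime (2 : ℤ) 3 from ⟨-1, 1, by norm_num⟩).pow
  have hg1 : g 1 = 0 := Int.eq_zero_of_abs_lt_dvd (hcop.dvd_of_dvd_mul_right hdvd) hsmall
  refine ⟨hg1, ?_, hg3⟩
  rw [hg1, zero_mul, zero_add] at hzZ
  exact (mul_eq_zero.mp hzZ).resolve_right (pow_ne_zero _ (by norm_num))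

set_option maxHeartbeats 800000 in
/-- **THE FOUR-TERM FORM BOUND** (hypothesis-free): every non-zero integer form in `(1, ℓ₂, ℓ₃, ρ_W)` satisfies
`exp(−(1+Σ|gᵢ|)^20) ≤ |g₀ + g₁ℓ₂ + g₂ℓ₃ + g₃ρ_W|`.  (Scale `N ≥ 6` least with `16H ≤ 2^{N!}`; at one of the three
cuts the truncation is non-zero — `formG4_three_cut` — hence at least the cut's resolution, twice the truncation
error; and `(N+2)! ≤ 65536 (1+H)^4` by minimality.) -/
theorem form_lower_bound_G4 (g : Fin 4 → ℤ) (hg : g ≠ 0) :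
    Real.exp (-((1 + ∑ i, (|g i| : ℝ)) ^ 20)) ≤
      |(g 0 : ℝ) + g 1 * liouvilleNumber 2 + g 2 * liouvilleNumber 3 + g 3 * rhoW| := by
  classical
  set HR : ℝ := ∑ i, (|g i| : ℝ) with hHR
  have hHR0 : 0 ≤ HR := by
    rw [hHR]; exact Finset.sum_nonneg fun i _ => by exact_mod_cast abs_nonneg (g i)
  have hexp1 : Real.exp (-((1 + HR) ^ 20)) ≤ 1 := by
    rw [Real.exp_le_one_iff]
    have : (0 : ℝ) ≤ (1 + HR) ^ 20 := by positivity
    linarith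
  by_cases h123 : g 1 = 0 ∧ g 2 = 0 ∧ g 3 = 0
  · -- `φ = g₀`, a non-zero integer
    have hg0 : g 0 ≠ 0 := by
      intro h0; apply hg; funext i
      fin_cases i <;> simp [h0, h123.1, h123.2.1, h123.2.2]
    have h1 : (1 : ℝ) ≤ |(g 0 : ℝ) + g 1 * liouvilleNumber 2 + g 2 * liouvilleNumber 3 + g 3 * rhoW| := by
      simp only [h123.1, h123.2.1, h123.2.2, Int.cast_zero, zero_mul, add_zero]
      exact_mod_cast Int.one_le_abs hg0
    linarith
  · -- the natural height `Hn` and the scale `N = K₀ + 6`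
    set Hn : ℕ := ∑ i, (g i).natAbs with hHn
    have hHRn : HR = (Hn : ℝ) := by
      rw [hHR, hHn, Nat.cast_sum]
      refine Finset.sum_congr rfl fun i _ => ?_
      simp only [Nat.cast_natAbs, Int.cast_abs]
    have hHn1 : 1 ≤ Hn := by
      obtain ⟨i, hi⟩ := Function.ne_iff.mp hg
      have hi' : g i ≠ 0 := by simpa using hi
      have h1 : 1 ≤ (g i).natAbs := Int.natAbs_pos.mpr hi'
      exact h1.trans (Finset.single_le_sum (f := fun i => (g i).natAbs) (fun _ _ => Nat.zero_le _)
        (Finset.mem_univ i))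
    have hex : ∃ K : ℕ, 16 * Hn ≤ 2 ^ (K + 6)! := by
      refine ⟨16 * Hn, (Nat.lt_two_pow_self).le.trans (Nat.pow_le_pow_right (by norm_num) ?_)⟩
      exact (Nat.le_add_right _ _).trans (Nat.self_le_factorial _)
    set K₀ : ℕ := Nat.find hex with hK₀
    have hK₀spec : 16 * Hn ≤ 2 ^ (K₀ + 6)! := Nat.find_spec hex
    set N : ℕ := K₀ + 6 with hN
    have hN6 : 6 ≤ N := by omega
    have hHN : 16 * Hn ≤ 2 ^ N ! := hK₀spec
    -- `(N+2)! ≤ 65536 (1+Hn)^4`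
    have hfac : (N + 1 + 1)! ≤ 65536 * (1 + Hn) ^ 4 := by
      rcases Nat.eq_zero_or_pos K₀ with hz | hpos
      · have h8 : (N + 1 + 1)! = 40320 := by rw [hN, hz]; rfl
        have h1 : 1 ≤ (1 + Hn) ^ 4 := Nat.one_le_pow _ _ (by omega)
        omega
      · have hmin := Nat.find_min hex (m := K₀ - 1) (by omega)
        rw [show K₀ - 1 + 6 = K₀ + 5 by omega] at hmin
        have hlt : (K₀ + 5)! < 16 * Hn := (Nat.lt_two_pow_self).trans (not_le.mp hmin)
        have hK5 : K₀ + 5 ≤ (K₀ + 5)! := Nat.self_le_factorial _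
        rw [hN, show K₀ + 6 + 1 + 1 = (K₀ + 5) + 1 + 1 + 1 by omega, Nat.factorial_succ, Nat.factorial_succ,
          Nat.factorial_succ]
        have h1 : K₀ + 5 + 1 + 1 + 1 ≤ 16 * (1 + Hn) := by omega
        have h2 : K₀ + 5 + 1 + 1 ≤ 16 * (1 + Hn) := by omega
        have h3 : K₀ + 5 + 1 ≤ 16 * (1 + Hn) := by omega
        have h4 : (K₀ + 5)! ≤ 16 * (1 + Hn) := by omega
        calc (K₀ + 5 + 1 + 1 + 1) * ((K₀ + 5 + 1 + 1) * ((K₀ + 5 + 1) * (K₀ + 5)!))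
            ≤ (16 * (1 + Hn)) * ((16 * (1 + Hn)) * ((16 * (1 + Hn)) * (16 * (1 + Hn)))) :=
              Nat.mul_le_mul h1 (Nat.mul_le_mul h2 (Nat.mul_le_mul h3 h4))
          _ = 65536 * (1 + Hn) ^ 4 := by ring
    have hfacR : (((N + 1 + 1)! : ℕ) : ℝ) ≤ 65536 * (1 + HR) ^ 4 := by
      rw [hHRn]; exact_mod_cast hfac
    -- the target in terms of `2^{−(N+2)!}`
    have hgoal : Real.exp (-((1 + HR) ^ 20)) ≤ 1 / (2 : ℝ) ^ (N + 1 + 1)! := by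
      have hX2 : (2 : ℝ) ≤ 1 + HR := by
        rw [hHRn]; exact_mod_cast (show 2 ≤ 1 + Hn by omega)
      have hp16 : (65536 : ℝ) ≤ (1 + HR) ^ 16 := by
        calc (65536 : ℝ) = 2 ^ 16 := by norm_num
          _ ≤ (1 + HR) ^ 16 := pow_le_pow_left₀ (by norm_num) hX2 16
      have h4 : (1 : ℝ) ≤ (1 + HR) ^ 4 := one_le_pow₀ (by linarith)
      have hE : (((N + 1 + 1)! : ℕ) : ℝ) ≤ (1 + HR) ^ 20 := by
        have h20 : (1 + HR) ^ 20 = (1 + HR) ^ 4 * (1 + HR) ^ 16 := by rw [← pow_add]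
        rw [h20]
        nlinarith [hfacR, h4, hp16]
      have hlog2 : Real.log 2 ≤ 1 := by have := Real.log_two_lt_d9; linarith
      have e1 : 1 / (2 : ℝ) ^ (N + 1 + 1)! = Real.exp (-((((N + 1 + 1)! : ℕ) : ℝ) * Real.log 2)) := by
        rw [Real.exp_neg, Real.exp_nat_mul, Real.exp_log two_pos, one_div]
      rw [e1, Real.exp_le_exp, neg_le_neg_iff]
      calc (((N + 1 + 1)! : ℕ) : ℝ) * Real.log 2 ≤ (((N + 1 + 1)! : ℕ) : ℝ) * 1 :=
            mul_le_mul_of_nonneg_left hlog2 (by positivity)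
        _ ≤ (1 + HR) ^ 20 := by rw [mul_one]; exact hE
    -- `|g₁| < 2^{(N+1)!}`
    have hsmall : |g 1| < (2 : ℤ) ^ (N + 1)! := by
      have h1 : (g 1).natAbs ≤ Hn :=
        Finset.single_le_sum (f := fun i => (g i).natAbs) (fun _ _ => Nat.zero_le _) (Finset.mem_univ 1)
      have h2 : Hn < 2 ^ N ! := by have := Nat.two_pow_pos (N !); omega
      have h3 : 2 ^ N ! ≤ 2 ^ (N + 1)! := Nat.pow_le_pow_right (by norm_num) (Nat.factorial_le (by omega))
      have h4 : (g 1).natAbs < 2 ^ (N + 1)! := by omega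
      have h5 : (((g 1).natAbs : ℕ) : ℤ) < ((2 ^ (N + 1)! : ℕ) : ℤ) := by exact_mod_cast h4
      rwa [Int.natCast_natAbs, Nat.cast_pow, Nat.cast_ofNat] at h5
    -- the truncation errors: exponents `≥ e + 2·k + N!` make the error `≤ (1/(2^e 3^k))/2` (`3^k ≤ 4^k`, `16H ≤ 2^{N!}`)
    have h12sum : |(g 1 : ℝ)| + |(g 2 : ℝ)| ≤ HR := by
      rw [hHR, Fin.sum_univ_four]; linarith [abs_nonneg (g 0 : ℝ), abs_nonneg (g 3 : ℝ)]
    have h3sum : |(g 3 : ℝ)| ≤ HR := by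
      rw [hHR, Fin.sum_univ_four]
      linarith [abs_nonneg (g 0 : ℝ), abs_nonneg (g 1 : ℝ), abs_nonneg (g 2 : ℝ)]
    have hHNR : 16 * HR ≤ (2 : ℝ) ^ N ! := by rw [hHRn]; exact_mod_cast hHN
    have herr : ∀ {e k f₁ f₂ : ℕ}, e + 2 * k + N ! ≤ f₁ → e + 2 * k + N ! ≤ f₂ →
        (|(g 1 : ℝ)| + |(g 2 : ℝ)|) * (2 / 2 ^ f₁) + |(g 3 : ℝ)| * (2 / (2 : ℝ) ^ f₂) ≤
          1 / ((2 : ℝ) ^ e * 3 ^ k) / 2 := by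
      intro e k f₁ f₂ hf₁ hf₂
      have b1 : (2 : ℝ) / 2 ^ f₁ ≤ 2 / 2 ^ (e + 2 * k + N !) :=
        div_le_div_of_nonneg_left (by norm_num) (by positivity) (pow_le_pow_right₀ (by norm_num) hf₁)
      have b2 : (2 : ℝ) / 2 ^ f₂ ≤ 2 / 2 ^ (e + 2 * k + N !) :=
        div_le_div_of_nonneg_left (by norm_num) (by positivity) (pow_le_pow_right₀ (by norm_num) hf₂)
      have h3k : (3 : ℝ) ^ k ≤ 2 ^ (2 * k) := by
        rw [pow_mul]; exact pow_le_pow_left₀ (by norm_num) (by norm_num) k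
      have hpe : (0 : ℝ) < 2 ^ e := by positivity
      have h3k0 : (0 : ℝ) < 3 ^ k := by positivity
      have hsplit : (2 : ℝ) ^ (e + 2 * k + N !) = 2 ^ e * 2 ^ (2 * k) * 2 ^ N ! := by rw [pow_add, pow_add]
      have key : 2 * HR * (2 / (2 : ℝ) ^ (e + 2 * k + N !)) ≤ 1 / ((2 : ℝ) ^ e * 3 ^ k) / 2 := by
        rw [hsplit, div_div, mul_div_assoc', div_le_div_iff₀ (by positivity) (by positivity), one_mul]
        calc 2 * HR * 2 * (2 ^ e * 3 ^ k * 2) = (2 ^ e) * ((8 * HR) * 3 ^ k) := by ring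
          _ ≤ (2 ^ e) * (2 ^ N ! * 2 ^ (2 * k)) := by
              refine mul_le_mul_of_nonneg_left ?_ hpe.le
              exact mul_le_mul (by linarith) h3k h3k0.le (by positivity)
          _ = 2 ^ e * 2 ^ (2 * k) * 2 ^ N ! := by ring
      calc (|(g 1 : ℝ)| + |(g 2 : ℝ)|) * (2 / 2 ^ f₁) + |(g 3 : ℝ)| * (2 / (2 : ℝ) ^ f₂)
          ≤ HR * (2 / 2 ^ (e + 2 * k + N !)) + HR * (2 / 2 ^ (e + 2 * k + N !)) := by
            gcongr
        _ = 2 * HR * (2 / (2 : ℝ) ^ (e + 2 * k + N !)) := by ring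
        _ ≤ 1 / ((2 : ℝ) ^ e * 3 ^ k) / 2 := key
    -- finishing move at a non-vanishing cut of resolution `1/(2^e 3^k)` with `e + 2k + 1 ≤ (N+2)!`
    set frm : ℝ := (g 0 : ℝ) + g 1 * liouvilleNumber 2 + g 2 * liouvilleNumber 3 + g 3 * rhoW with hfrm
    have finish : ∀ {e k : ℕ} {Φ : ℝ}, e + 2 * k + 1 ≤ (N + 1 + 1)! → 1 / ((2 : ℝ) ^ e * 3 ^ k) ≤ |Φ| →
        |frm - Φ| ≤ 1 / ((2 : ℝ) ^ e * 3 ^ k) / 2 → Real.exp (-((1 + HR) ^ 20)) ≤ |frm| := by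
      intro e k Φ he hlow happ
      have h1 : |Φ| - |frm - Φ| ≤ |frm| := by
        have := abs_sub_abs_le_abs_sub Φ frm
        rw [abs_sub_comm Φ frm] at this
        linarith
      have h3k : (3 : ℝ) ^ k ≤ 2 ^ (2 * k) := by
        rw [pow_mul]; exact pow_le_pow_left₀ (by norm_num) (by norm_num) k
      have hden : (2 : ℝ) ^ e * 3 ^ k * 2 ≤ 2 ^ (N + 1 + 1)! := by
        calc (2 : ℝ) ^ e * 3 ^ k * 2 ≤ 2 ^ e * 2 ^ (2 * k) * 2 := by gcongr
          _ = 2 ^ (e + 2 * k + 1) := by rw [pow_add, pow_add, pow_one]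
          _ ≤ 2 ^ (N + 1 + 1)! := pow_le_pow_right₀ (by norm_num) he
      have h2 : 1 / (2 : ℝ) ^ (N + 1 + 1)! ≤ 1 / ((2 : ℝ) ^ e * 3 ^ k) / 2 := by
        rw [div_div]
        exact one_div_le_one_div_of_le (by positivity) hden
      linarith [hgoal]
    -- bookkeeping inequalities between the exponents
    have i1 : N ! ≤ cW N := le_trans (Nat.le_mul_of_pos_left _ two_pos) (two_mul_factorial_le_cW N)
    have i2 : cW N + 3 * N ! ≤ (N + 1)! := cW_add_three_mul_factorial_le hN6
    have i2' : cW (N + 1) + 3 * (N + 1)! ≤ (N + 1 + 1)! := cW_add_three_mul_factorial_le (by omega)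
    have i3 : 4 * (N + 1)! ≤ cW (N + 1) := four_mul_factorial_le_cW (by omega)
    have i4 : 2 * (N + 1 + 1)! ≤ cW (N + 1 + 1) := two_mul_factorial_le_cW (N + 1 + 1)
    have i6 : N ! ≤ (N + 1)! := Nat.factorial_le (Nat.le_succ N)
    have i8 : 8 * (N + 1)! ≤ (N + 1 + 1)! := by
      rw [Nat.factorial_succ (N + 1)]; exact Nat.mul_le_mul_right _ (by omega)
    have i9 : 1 ≤ N ! := Nat.factorial_pos N
    by_cases hΦ1 : (g 0 : ℝ) + g 1 * partialSum 2 N + g 2 * partialSum 3 N + g 3 * tW N ≠ 0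
    · -- cut `(N, N)`, resolution `2^{−c_N} 3^{−N!}`
      refine finish (e := cW N) (k := N !) (by omega) (formG4_scale_lower g i1 le_rfl hΦ1)
        ((formG4_approx g N N).trans (herr (by omega) (by omega)))
    by_cases hΦ2 : (g 0 : ℝ) + g 1 * partialSum 2 (N + 1) + g 2 * partialSum 3 (N + 1) + g 3 * tW N ≠ 0
    · -- cut `(N+1, N)`, resolution `6^{−(N+1)!}`
      refine finish (e := (N + 1)!) (k := (N + 1)!) (by omega) (formG4_scale_lower g le_rfl (by omega) hΦ2)
        ((formG4_approx g (N + 1) N).trans (herr (by omega) (by omega)))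
    by_cases hΦ3 : (g 0 : ℝ) + g 1 * partialSum 2 (N + 1) + g 2 * partialSum 3 (N + 1) + g 3 * tW (N + 1) ≠ 0
    · -- cut `(N+1, N+1)`, resolution `2^{−c_{N+1}} 3^{−(N+1)!}`
      refine finish (e := cW (N + 1)) (k := (N + 1)!) (by omega) (formG4_scale_lower g (by omega) le_rfl hΦ3)
        ((formG4_approx g (N + 1) (N + 1)).trans (herr (by omega) (by omega)))
    · exact absurd (formG4_three_cut g N (not_not.mp hΦ1) (not_not.mp hΦ2) (not_not.mp hΦ3) hsmall) h123

/-- An integer form in `z_G` is the real number `g₀ + g₁ ℓ₂ + g₂ ℓ₃ + g₃ ρ_W`. -/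
theorem zG4_form (g : Fin 4 → ℤ) :
    ∑ i, (g i : ℂ) * zG4 i =
      (((g 0 : ℝ) + g 1 * liouvilleNumber 2 + g 2 * liouvilleNumber 3 + g 3 * rhoW : ℝ) : ℂ) := by
  rw [Fin.sum_univ_four]
  simp only [zG4, Matrix.cons_val_zero, Matrix.cons_val_one, Matrix.cons_val_two, Matrix.cons_val,
    Matrix.head_cons, Matrix.tail_cons]
  push_cast; ring

/-- `∑ i, (g i : ℂ) * zG4pi i = (Real.pi : ℂ) * (((g 0 : ℝ) + g 1 * liouvilleNumber 2 + g 2 * liouvilleNumber 3 + g 3 * rhoW : ℝ) : ℂ)`. -/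
theorem zG4pi_form (g : Fin 4 → ℤ) :
    ∑ i, (g i : ℂ) * zG4pi i =
      (Real.pi : ℂ) * (((g 0 : ℝ) + g 1 * liouvilleNumber 2 + g 2 * liouvilleNumber 3 + g 3 * rhoW : ℝ) : ℂ) := by
  rw [Fin.sum_univ_four]
  simp only [zG4pi, Matrix.cons_val_zero, Matrix.cons_val_one, Matrix.cons_val_two, Matrix.cons_val,
    Matrix.head_cons, Matrix.tail_cons]
  push_cast; ring

/-- `‖∑ i, (g i : ℂ) * zG4 i‖ = |(g 0 : ℝ) + g 1 * liouvilleNumber 2 + g 2 * liouvilleNumber 3 + g 3 * rhoW|`. -/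
theorem norm_zG4_form (g : Fin 4 → ℤ) :
    ‖∑ i, (g i : ℂ) * zG4 i‖ = |(g 0 : ℝ) + g 1 * liouvilleNumber 2 + g 2 * liouvilleNumber 3 + g 3 * rhoW| := by
  rw [zG4_form, Complex.norm_real, Real.norm_eq_abs]

/-- `‖∑ i, (g i : ℂ) * zG4pi i‖ = Real.pi * |(g 0 : ℝ) + g 1 * liouvilleNumber 2 + g 2 * liouvilleNumber 3 + g 3 * rhoW|`. -/
theorem norm_zG4pi_form (g : Fin 4 → ℤ) :
    ‖∑ i, (g i : ℂ) * zG4pi i‖ =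
      Real.pi * |(g 0 : ℝ) + g 1 * liouvilleNumber 2 + g 2 * liouvilleNumber 3 + g 3 * rhoW| := by
  rw [zG4pi_form, norm_mul, Complex.norm_real, Complex.norm_real, Real.norm_eq_abs, Real.norm_eq_abs,
    abs_of_pos Real.pi_pos]

/-- **(iii) `z_G = (1, ℓ₂, ℓ₃, ρ_W)` has NO hyper-small integer forms** (the four-term bound; hypothesis-free). -/
theorem not_hyperLinLiouville_zG4 : ¬ HyperLinLiouville zG4 := by
  intro hH
  obtain ⟨g, hg, hlt⟩ := hH 20
  rw [norm_zG4_form] at hlt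
  have hlow := form_lower_bound_G4 g hg
  linarith

/-- **(iii^π) `z_G^π` has NO hyper-small integer forms** (hypothesis-free). -/
theorem not_hyperLinLiouville_zG4pi : ¬ HyperLinLiouville zG4pi := by
  intro hH
  obtain ⟨g, hg, hlt⟩ := hH 20
  rw [norm_zG4pi_form] at hlt
  have hlow := form_lower_bound_G4 g hg
  have hπ : (1 : ℝ) ≤ Real.pi := by have := Real.pi_gt_three; linarith
  have habs := abs_nonneg ((g 0 : ℝ) + g 1 * liouvilleNumber 2 + g 2 * liouvilleNumber 3 + g 3 * rhoW)
  nlinarith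

/-- **`z_G` lies in the scope of item 33364** — all three hypotheses, HYPOTHESIS-FREE (text of the binders). -/
theorem zG4_in_scope_33364 :
    LinearIndependent ℚ zG4 ∧
    (∀ ω : ℕ, ∃ h : Fin 4 → ℤ, h ≠ 0 ∧ ‖∑ i, (h i : ℂ) * zG4 i‖ < 1 / (1 + ∑ i, (|h i| : ℝ)) ^ ω) ∧
    (¬ ∀ m : ℕ, ∃ h : Fin 4 → ℤ, h ≠ 0 ∧
      ‖∑ i, (h i : ℂ) * zG4 i‖ < Real.exp (-((1 + ∑ i, (|h i| : ℝ)) ^ m))) :=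
  ⟨linearIndependent_zG4, linLiouville_zG4, not_hyperLinLiouville_zG4⟩

/-- `LinearIndependent ℚ zG4pi ∧ (∀ ω : ℕ, ∃ h : Fin 4 → ℤ, h ≠ 0 ∧ ‖∑ i, (h i : ℂ) * zG4pi i‖ < 1 / (1 + ∑ i, (|h i| : ℝ)) ^ ω) ∧ (¬ ∀ m : ℕ, ∃ h : Fin 4 → ℤ, h ≠ 0 ∧ ‖∑ i, (h i : ℂ) * zG4pi i‖ < Real.exp (-((1 + ∑ i, (|h i|`. -/
theorem zG4pi_in_scope_33364 :
    LinearIndependent ℚ zG4pi ∧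
    (∀ ω : ℕ, ∃ h : Fin 4 → ℤ, h ≠ 0 ∧ ‖∑ i, (h i : ℂ) * zG4pi i‖ < 1 / (1 + ∑ i, (|h i| : ℝ)) ^ ω) ∧
    (¬ ∀ m : ℕ, ∃ h : Fin 4 → ℤ, h ≠ 0 ∧
      ‖∑ i, (h i : ℂ) * zG4pi i‖ < Real.exp (-((1 + ∑ i, (|h i| : ℝ)) ^ m))) :=
  ⟨linearIndependent_zG4pi, linLiouville_zG4pi, not_hyperLinLiouville_zG4pi⟩

/-- **ITEM 33364 DECIDED AT THE WALL-4 MEMBER `z_G`** (mod `hNW`): scope (i)–(iii) hypothesis-free AND the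
conclusion. -/
theorem finiteOrderLiouvilleSchanuel_at_zG4 (hNW : NWMeasure) :
    LinearIndependent ℚ zG4 ∧ LinLiouville zG4 ∧ ¬ HyperLinLiouville zG4 ∧ SB 4 zG4 :=
  ⟨linearIndependent_zG4, linLiouville_zG4, not_hyperLinLiouville_zG4, sb_zG4 hNW⟩

/-- **ITEM 33364 DECIDED AT `z_G^π` — HYPOTHESIS-FREE.** -/
theorem finiteOrderLiouvilleSchanuel_at_zG4pi :
    LinearIndependent ℚ zG4pi ∧ LinLiouville zG4pi ∧ ¬ HyperLinLiouville zG4pi ∧ SB 4 zG4pi :=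
  ⟨linearIndependent_zG4pi, linLiouville_zG4pi, not_hyperLinLiouville_zG4pi, sb_zG4pi⟩

/-- **THE LIVE ITEM 33364 APPLIED at `z_G`** (its text as a hypothesis; the member discharges all binders). -/
theorem item33364_at_zG4
    (h33364 : ∀ (n : ℕ) (z : Fin n → ℂ), LinearIndependent ℚ z →
      (∀ ω : ℕ, ∃ h : Fin n → ℤ, h ≠ 0 ∧ ‖∑ i, (h i : ℂ) * z i‖ < 1 / (1 + ∑ i, (|h i| : ℝ)) ^ ω) →
      (¬ ∀ m : ℕ, ∃ h : Fin n → ℤ, h ≠ 0 ∧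
        ‖∑ i, (h i : ℂ) * z i‖ < Real.exp (-((1 + ∑ i, (|h i| : ℝ)) ^ m))) →
      (n : Cardinal) ≤ Algebra.trdeg ℚ
        ↥(IntermediateField.adjoin ℚ (Set.range z ∪ Set.range (Complex.exp ∘ z)))) :
    SB 4 zG4 := h33364 4 zG4 linearIndependent_zG4 linLiouville_zG4 not_hyperLinLiouville_zG4

end FourScales

end Summit.Schanuel.Schanuel.Theorems.RootDecomp1KGapCell
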